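import Summits.ValiantsHypothesis.ValiantsHypothesis.Theorems.LacunarySymmetroidMatrixDescartesWLawTwoSignCell

/-!
# `MatrixDescartes` census — pivot column at `m = 2`: the `2K` law holds whenever `det J ≥ 0`
# (negative-semidefinite or singular pivot letter); only the INDEFINITE pivot is open

HONEST FRAMING.  Object-search cell `pub-symmetroid`, Conjecture-B column in PIVOT currency (`…CensusPivotDefs.lean`, seat conjb-1),
seat `val-sym-mdr-p1` (generation 6).  Helper file landed `--supports` the crux item stmt-ValiantsHypothesis-18050
(`Theses.LacunarySymmetroid.MatrixDescartes`, OPEN, on HOLD) with NO closure claim.  A SECTOR LAW for the `(2, K)` pivot rows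
(`Z₊ ≤ 2K` conjectured by the lineage for every `K`; tree: `≤ 2K + 2` always, `= 6` at `K = 3`, `≥ 8` at `K = 4`), read off the
SIGN-CELL LAW of `…WLawTwoSignCell` (seat val-sym-mdr-p2 g6: a negative coefficient of `det F` sits at `2e` only if `det J < 0`):

* **`pivotTwo_posRoots_le_two_mul_of_det_nonneg`**: for a `2 × 2` pivot pencil `X^e J + ∑ X^{dₖ} Pₖ` (`Pₖ ⪰ 0`, `J` ANY real `2 × 2`
  matrix, any exponents, ties and letters at the pivot exponent allowed) with `det J ≥ 0`, `Z₊ ≤ 2K`.  (If no letter sits at the pivot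
  exponent, the negative coefficients sit among the `K` degrees `e + dₖ`; if some `dₖ = e`, the `K + 1` pivot degrees take at most `K`
  values.)  Corollaries: **`…_of_negSemidef_pivot`** (`J ⪯ 0`, i.e. pivot index two with a definite sign: `Z₊ ≤ 2K`) and
  `…_of_det_eq_zero` (rank `≤ 1` pivot letter of either sign).
* **REDUCTION TO THE INDEFINITE PIVOT** (`pivotRootLawAt_two_of_indefinite`): if every `2 × 2` pivot pencil with `det J < 0`
  (`J` indefinite: exactly one negative and one positive eigenvalue) has `Z₊ ≤ 2K`, then `PivotRootLawAt 2 K q (2K)` for every index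
  `q`.  So the open content of the `m = 2` pivot law is the indefinite pivot — the case of the lineage's `K = 4` witness (`J` a multiple
  of `antidiag(1,1)`, `…PivotTwoFourWitness`) and of the `K = 3` extremal configurations.
Nothing here bears on `Theses.LacunarySymmetroid.MatrixDescartes` in its window, on `KPlusLogSqLaw`, on `DoorA26` / `DoorA34`, on the
cell's registers or credences, or on `VP ≠ VNP`.

[folklore] Descartes' rule with a negative-support budget; tree lemmas `WLawTwoSignCell.pivotTwo_posRoots_le_signCell`,
`Pivot.TwoDescartes.card_posRoots_le_two_mul_card`, `Pivot.TwoDescartes.coeff_det_nonneg_of_not_mem`.  No definitions, no named facts.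
-/

-- `Summit.ValiantsHypothesis.ValiantsHypothesis.…` repeats a component by the D-0017 layout
-- (single-conjunct summit), which the `dupNamespace` linter flags; the name is mandated.
set_option linter.dupNamespace false

namespace Summit.ValiantsHypothesis.ValiantsHypothesis.Theorems.LacunarySymmetroidMatrixDescartes.Pivot.DefinitePivot

open Matrix Finset Polynomial
open scoped BigOperators
open Pivot.TwoDescartes (letter expo pencil_eq_sum card_posRoots_le_two_mul_card coeff_det_nonneg_of_not_mem)

variable {K : ℕ}

/-- **`det J ≥ 0 ⇒ Z₊ ≤ 2K`** for every `2 × 2` pivot pencil with PSD letters (`J` any real `2 × 2` matrix, any exponents). [folklore] -/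
theorem pivotTwo_posRoots_le_two_mul_of_det_nonneg (e : ℕ) (d : Fin K → ℕ) (J : Matrix (Fin 2) (Fin 2) ℝ)
    (P : Fin K → Matrix (Fin 2) (Fin 2) ℝ) (hP : ∀ k, (P k).PosSemidef) (hJ : 0 ≤ J.det) :
    ((Matrix.det (((X : ℝ[X]) ^ e) • J.map Polynomial.C
        + ∑ k, ((X : ℝ[X]) ^ d k) • (P k).map Polynomial.C)).roots.toFinset.filter (fun t => 0 < t)).card
      ≤ 2 * K := by
  classical
  set T : Finset ℕ := (Finset.univ : Finset (Fin K)).image (fun k => e + d k) with hT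
  have hTcard : T.card ≤ K := le_trans Finset.card_image_le (by simp)
  by_cases hd : ∀ k, d k ≠ e
  · -- no letter at the pivot exponent: the sign-cell law with `T = {e + dₖ}`
    have h := WLawTwoSignCell.pivotTwo_posRoots_le_signCell e d J P hP hd T (fun hlt => absurd hJ (not_le.mpr hlt))
      (fun k _ => Finset.mem_image.mpr ⟨k, Finset.mem_univ _, rfl⟩)
    exact h.trans (by omega)
  · -- a letter sits at the pivot exponent: the `K + 1` pivot degrees take at most `K` values
    push Not at hd
    obtain ⟨k₀, hk₀⟩ := hd
    rw [pencil_eq_sum]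
    have hneg : ∀ n, (Matrix.det (∑ l, ((X : ℝ[X]) ^ expo e d l) • (letter J P l).map Polynomial.C)).coeff n < 0 →
        n ∈ T := by
      intro n hn
      by_contra hnot
      have hn' : ∀ l, e + expo e d l ≠ n := by
        intro l hl
        rcases l with _ | k
        · exact hnot (Finset.mem_image.mpr ⟨k₀, Finset.mem_univ _, by rw [hk₀]; exact hl⟩)
        · exact hnot (Finset.mem_image.mpr ⟨k, Finset.mem_univ _, hl⟩)
      exact absurd hn (not_lt.mpr (coeff_det_nonneg_of_not_mem e d J P hP n hn'))
    exact (card_posRoots_le_two_mul_card _ T hneg).trans (by omega)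

/-- **NSD pivot ⇒ `Z₊ ≤ 2K`**: a `2 × 2` pivot pencil whose pivot letter is negative semidefinite (`−J ⪰ 0`) with `K` PSD letters
has at most `2K` distinct positive determinant roots. [folklore] -/
theorem pivotTwo_posRoots_le_two_mul_of_negSemidef_pivot (e : ℕ) (d : Fin K → ℕ) (J : Matrix (Fin 2) (Fin 2) ℝ)
    (P : Fin K → Matrix (Fin 2) (Fin 2) ℝ) (hP : ∀ k, (P k).PosSemidef) (hJ : (-J).PosSemidef) :
    ((Matrix.det (((X : ℝ[X]) ^ e) • J.map Polynomial.C
        + ∑ k, ((X : ℝ[X]) ^ d k) • (P k).map Polynomial.C)).roots.toFinset.filter (fun t => 0 < t)).card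
      ≤ 2 * K := by
  refine pivotTwo_posRoots_le_two_mul_of_det_nonneg e d J P hP ?_
  have h := hJ.det_nonneg
  rwa [Matrix.det_neg, Fintype.card_fin, show ((-1 : ℝ) ^ 2) = 1 by norm_num, one_mul] at h

/-- **Singular pivot ⇒ `Z₊ ≤ 2K`** (pivot letter of rank `≤ 1`, either sign). [folklore] -/
theorem pivotTwo_posRoots_le_two_mul_of_det_eq_zero (e : ℕ) (d : Fin K → ℕ) (J : Matrix (Fin 2) (Fin 2) ℝ)
    (P : Fin K → Matrix (Fin 2) (Fin 2) ℝ) (hP : ∀ k, (P k).PosSemidef) (hJ : J.det = 0) :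
    ((Matrix.det (((X : ℝ[X]) ^ e) • J.map Polynomial.C
        + ∑ k, ((X : ℝ[X]) ^ d k) • (P k).map Polynomial.C)).roots.toFinset.filter (fun t => 0 < t)).card
      ≤ 2 * K :=
  pivotTwo_posRoots_le_two_mul_of_det_nonneg e d J P hP hJ.symm.le

/-- In pivot currency: `det J ≥ 0 ⇒ pivotPosRoots e d J P ≤ 2K`. [folklore] -/
theorem pivotPosRoots_le_two_mul_of_det_nonneg (e : ℕ) (d : Fin K → ℕ) (J : Matrix (Fin 2) (Fin 2) ℝ)
    (P : Fin K → Matrix (Fin 2) (Fin 2) ℝ) (hP : ∀ k, (P k).PosSemidef) (hJ : 0 ≤ J.det) :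
    pivotPosRoots e d J P ≤ 2 * K :=
  pivotTwo_posRoots_le_two_mul_of_det_nonneg e d J P hP hJ

/-- **REDUCTION TO THE INDEFINITE PIVOT.**  If every `2 × 2` pivot pencil with an INDEFINITE pivot letter (`det J < 0`, `J`
symmetric, `Pₖ ⪰ 0`) has `Z₊ ≤ 2K`, then the row `PivotRootLawAt 2 K q (2K)` holds for every index `q`. [folklore] -/
theorem pivotRootLawAt_two_of_indefinite (K q : ℕ)
    (h : ∀ (e : ℕ) (d : Fin K → ℕ) (J : Matrix (Fin 2) (Fin 2) ℝ) (P : Fin K → Matrix (Fin 2) (Fin 2) ℝ),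
      J.IsSymm → (∀ k, (P k).PosSemidef) → J.det < 0 → pivotPosRoots e d J P ≤ 2 * K) :
    PivotRootLawAt 2 K q (2 * K) := by
  intro e d J P hJ hP _hW
  rcases lt_or_ge J.det 0 with hlt | hge
  · exact h e d J P hJ hP hlt
  · exact pivotPosRoots_le_two_mul_of_det_nonneg e d J P hP hge

end Summit.ValiantsHypothesis.ValiantsHypothesis.Theorems.LacunarySymmetroidMatrixDescartes.Pivot.DefinitePivot
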